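import Mathlib
import Literature.Probability.LatticeModels.GKSInequalities
import Summits.CriticalPhenomena.Ising3DConformalLimit.Theses.PrecisionLaplacian
import HarnessLib

/-!
# Crux `PrecisionLaplacian.InverseMFerromagnet` (stmt-CriticalPhenomena-4798), line `Sketch` —
# stub `stub_cofactorSign_of_posV` (core B, bridge B1: evaluation bridge)

THEOREM-ONLY file (no definitions).  For the zero-field pair ferromagnet `gksSum univ K C` on
`Fin n` (`K ≥ 0`, `|C_i| = 2`) write `v_i := e^{2K_i} − 1 ≥ 0`.  Since `ω_{C_i} = ±1`,

  `e^{K_i ω_{C_i}} = e^{−K_i} · (1 + ((1 + ω_{C_i})/2) · v_i)`,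

so the Boltzmann weight is `(∏_i e^{−K_i}) · ∏_i (1 + ((1 + ω_{C_i})/2) v_i)` and the unnormalised
second-moment matrix `S_pq := ∑_ω σ_pσ_q e^{∑ K_iω_{C_i}}` is `c • eval_v M` with `c = ∏ e^{−K_i} > 0`
and `M_pq(X) := ∑_ω C(σ_pσ_q) ∏_i (1 + C((1+ω_{C_i})/2) X_i) ∈ ℝ[X_1,…,X_m]` (the Edwards–Sokal /
FK numerator polynomial matrix).  Ring homomorphisms commute with adjugates
(`RingHom.map_adjugate`) and `adj (c • A) = c^{n−1} • adj A` (`Matrix.adjugate_smul`), so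
`(adj S)_xy = c^{n−1} · eval_v ((adj M)_xy)`.  A polynomial all of whose coefficients are `≤ 0`
is `≤ 0` on the nonnegative orthant (`MvPolynomial.eval_eq'`).  Hence the hypothesis POS-v
(coefficientwise nonpositivity of the off-diagonal adjugate entries of `M`, the lead's open stub
`stub_posV`) implies `(adj S)_xy ≤ 0` for `x ≠ y`, which is the registered stub
`stub_cofactorSign_of_posV`.
-/

namespace Summit.CriticalPhenomena.Ising3DConformalLimit.Cruxes.InverseMFerromagnet.PartialCovarianceLadder

open Literature.Probability.LatticeModels Finset Matrix

/-- **One Boltzmann factor in the `v = e^{2K} − 1` variable**: for `s = ±1`,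
`e^{K s} = e^{−K} (1 + ((1+s)/2) (e^{2K} − 1))` (`s = 1`: `e^{−K} e^{2K} = e^{K}`; `s = −1`: both
sides are `e^{−K}`). [folklore] -/
theorem posV_exp_mul_eq (K : ℝ) {s : ℝ} (hs : s = 1 ∨ s = -1) :
    Real.exp (K * s) = Real.exp (-K) * (1 + (1 + s) / 2 * (Real.exp (2 * K) - 1)) := by
  rcases hs with rfl | rfl
  · have h : Real.exp (-K) * Real.exp (2 * K) = Real.exp (K * 1) := by
      rw [← Real.exp_add]
      congr 1
      ring
    rw [← h]
    ring
  · have h : K * -1 = -K := by ring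
    rw [h]
    ring

/-- **The Boltzmann weight in the `v`-variables**: `e^{∑_i K_i ω_{C_i}} = (∏_i e^{−K_i}) ·
∏_i (1 + ((1 + ω_{C_i})/2)(e^{2K_i} − 1))` (`Real.exp_sum` and the one-factor identity
`posV_exp_mul_eq`, using `ω_{C_i} = ±1`). [folklore] -/
theorem posV_gksWeight_eq {n m : ℕ} (K : Fin m → ℝ) (C : Fin m → Finset (Fin n))
    (ω : SpinConfig (Fin n)) :
    gksWeight Finset.univ K C ω =
      (∏ i, Real.exp (-K i)) *
        ∏ i, (1 + (1 + spinProduct (C i) ω) / 2 * (Real.exp (2 * K i) - 1)) := by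
  rw [gksWeight, gksHamiltonian, Real.exp_sum, ← Finset.prod_mul_distrib]
  exact Finset.prod_congr rfl fun i _ => posV_exp_mul_eq (K i) (spinProduct_eq_one_or (C i) ω)

/-- **Evaluation of the Edwards–Sokal entry**: evaluating
`∑_ω C(σ_pσ_q) ∏_i (1 + C((1+ω_{C_i})/2) X_i)` at a point `v` gives
`∑_ω σ_pσ_q ∏_i (1 + ((1+ω_{C_i})/2) v_i)` (`MvPolynomial.eval` is a ring homomorphism with
`eval_C`, `eval_X`). [folklore] -/
theorem posV_eval_entry {n m : ℕ} (C : Fin m → Finset (Fin n)) (v : Fin m → ℝ) (p q : Fin n) :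
    MvPolynomial.eval v (∑ ω : SpinConfig (Fin n), MvPolynomial.C (spinAt p ω * spinAt q ω) *
        ∏ i : Fin m, (1 + MvPolynomial.C ((1 + spinProduct (C i) ω) / 2) * MvPolynomial.X i)) =
      ∑ ω : SpinConfig (Fin n), spinAt p ω * spinAt q ω *
        ∏ i : Fin m, (1 + (1 + spinProduct (C i) ω) / 2 * v i) := by
  simp only [map_sum, map_mul, map_prod, map_add, map_one, MvPolynomial.eval_C, MvPolynomial.eval_X]

/-- **The unnormalised second-moment matrix is a positive multiple of the evaluated polynomial
matrix**: `S = (∏ e^{−K_i}) • (M.map (eval v))`, `v_i = e^{2K_i} − 1`. [folklore] -/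
theorem posV_matrix_eq {n m : ℕ} (K : Fin m → ℝ) (C : Fin m → Finset (Fin n)) :
    (Matrix.of fun p q : Fin n => gksSum Finset.univ K C (fun ω => spinAt p ω * spinAt q ω)) =
      (∏ i, Real.exp (-K i)) •
        (Matrix.of fun p q : Fin n => ∑ ω : SpinConfig (Fin n),
            MvPolynomial.C (spinAt p ω * spinAt q ω) *
              ∏ i : Fin m, (1 + MvPolynomial.C ((1 + spinProduct (C i) ω) / 2) * MvPolynomial.X i)
          : Matrix (Fin n) (Fin n) (MvPolynomial (Fin m) ℝ)).map
          (MvPolynomial.eval fun i => Real.exp (2 * K i) - 1) := by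
  ext p q
  simp only [Matrix.smul_apply, Matrix.map_apply, Matrix.of_apply, smul_eq_mul, gksSum]
  rw [posV_eval_entry, Finset.mul_sum]
  refine Finset.sum_congr rfl fun ω _ => ?_
  rw [posV_gksWeight_eq]
  ring

/-- **Adjugates commute with evaluation and scale homogeneously**: for a real `c`, a ring
homomorphism `φ` and a square matrix `M` over the source ring,
`adj (c • M.map φ) = c^{n−1} • (adj M).map φ` (`Matrix.adjugate_smul`, `RingHom.map_adjugate`).
[folklore] -/
theorem posV_adjugate_smul_map {n : ℕ} {R : Type*} [CommRing R] (φ : R →+* ℝ) (c : ℝ)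
    (M : Matrix (Fin n) (Fin n) R) :
    (c • M.map φ).adjugate = c ^ (n - 1) • M.adjugate.map φ := by
  rw [Matrix.adjugate_smul, Fintype.card_fin]
  congr 1
  have h := RingHom.map_adjugate φ M
  simp only [RingHom.mapMatrix_apply] at h
  exact h.symm

/-- **A polynomial with nonpositive coefficients is nonpositive on the nonnegative orthant**
(`eval v P = ∑_d coeff_d P · ∏_i v_i^{d_i}`, `MvPolynomial.eval_eq'`). [folklore] -/
theorem posV_eval_nonpos {m : ℕ} (P : MvPolynomial (Fin m) ℝ) (v : Fin m → ℝ)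
    (hP : ∀ d : Fin m →₀ ℕ, P.coeff d ≤ 0) (hv : ∀ i, 0 ≤ v i) :
    MvPolynomial.eval v P ≤ 0 := by
  rw [MvPolynomial.eval_eq']
  refine Finset.sum_nonpos fun d _ => mul_nonpos_of_nonpos_of_nonneg (hP d) ?_
  exact Finset.prod_nonneg fun i _ => pow_nonneg (hv i) _

/-- **B1 · evaluation bridge** (registered stub `stub_cofactorSign_of_posV` of line `Sketch`).
POS-v (every coefficient of every off-diagonal adjugate entry of the Edwards–Sokal polynomial matrix
`M_pq(X) = ∑_ω σ_pσ_q ∏_i (1 + ((1+ω_{C_i})/2)·X_i)` is `≤ 0`) implies that the off-diagonal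
adjugate entries of the unnormalised Boltzmann second-moment matrix `S_pq = gksSum univ K C (σ_pσ_q)`
are `≤ 0` for `K ≥ 0`: `S = (∏ e^{−K_i}) • eval_{X_i := e^{2K_i}−1} M`, `RingHom.map_adjugate`,
`Matrix.adjugate_smul`, and a polynomial with nonpositive coefficients is nonpositive on the
nonnegative orthant (`e^{2K_i} − 1 ≥ 0` because `K_i ≥ 0`). [folklore] -/
theorem stub_cofactorSign_of_posV : (∀ (n m : ℕ) (C : Fin m → Finset (Fin n)), (∀ i, (C i).card = 2) → ∀ x y : Fin n, x ≠ y → ∀ d : Fin m →₀ ℕ, ((Matrix.of fun p q : Fin n => ∑ ω : SpinConfig (Fin n), MvPolynomial.C (spinAt p ω * spinAt q ω) * ∏ i : Fin m, (1 + MvPolynomial.C ((1 + spinProduct (C i) ω) / 2) * MvPolynomial.X i) : Matrix (Fin n) (Fin n) (MvPolynomial (Fin m) ℝ)).adjugate x y).coeff d ≤ 0) → ∀ (n m : ℕ) (K : Fin m → ℝ) (C : Fin m → Finset (Fin n)), (∀ i, 0 ≤ K i) → (∀ i, (C i).card = 2) → ∀ x y : Fin n, x ≠ y → (Matrix.of fun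 p q : Fin n => gksSum Finset.univ K C (fun ω => spinAt p ω * spinAt q ω)).adjugate x y ≤ 0 := by
  intro hpos n m K C hK hC x y hxy
  rw [posV_matrix_eq K C, posV_adjugate_smul_map]
  simp only [Matrix.smul_apply, Matrix.map_apply, smul_eq_mul]
  refine mul_nonpos_of_nonneg_of_nonpos
    (pow_nonneg (Finset.prod_nonneg fun i _ => (Real.exp_pos _).le) _) ?_
  refine posV_eval_nonpos _ _ (fun d => hpos n m C hC x y hxy d) fun i => ?_
  exact sub_nonneg.2 (Real.one_le_exp (by linarith [hK i]))

end Summit.CriticalPhenomena.Ising3DConformalLimit.Cruxes.InverseMFerromagnet.PartialCovarianceLadder
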